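import Mathlib
import Literature.Analysis.FluidPDE.GaussianVortexPlanar
import Literature.Analysis.FluidPDE.GaussianVortexPlanarProofs
import Literature.Analysis.FluidPDE.BiotSavart2DSymmetry
import HarnessLib

/-!
# Tools for the Gallay–Wayne cell operator `Λ_G` (stub `stub_cellSolvability`)

Helper file for the stub `stub_cellSolvability` of the line `braid-closed-large-circulation-gluing`
(crux stmt-AnomalousDissipation-3009, `MarginalStabilityChain.StretchedVortexRows`). The stub asks
for solutions of the generalised Gallay–Wayne / Maekawa CELL PROBLEM `Λ_G w = g`, where
`Λ_G w = ⟪v^G, ∇w⟫ + ⟪K ∗ w, ∇G⟫` is the linearisation of the transport term at the Gaussian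
vortex `G` (Gallay–Wayne 2007, §1; Gallay–Maekawa 2016, §2.1), written pointwise in the
tree vocabulary of `Literature.Analysis.FluidPDE.GaussianVortexPlanar`
(`gaussVortexVelocity = v^G`, `biotSavart2D w = K ∗ w`, `gaussVortexProfile = G`). The radial
half of the structure (`Λ_G h = 0` for radial `h`, `v^G·∇w = Ω ∂_θ w`) is in the sibling file
`…StubCoreInverseTools` (`lamG_eq_zero_of_radial`; two of its one-line lemmas are re-proved here
as `private` copies so that the files stay independent); this file adds the ANGULAR half that the
Fourier analysis of the cell problem rests on. Everything is proved, nothing is assumed: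

* `gradient_gaussVortexProfile`: `∇G(ξ) = −(G(ξ)/2) ξ` (vector form), hence
  `⟪K∗w(ξ), ∇G(ξ)⟫ = −(G(ξ)/2) ⟪K∗w(ξ), ξ⟫` — only the RADIAL velocity of `w` enters `Λ_G`;
* point symmetry: `v^G`, `K_{2D}`, `∇G` are odd, the Biot–Savart velocity and the gradient of an
  EVEN vorticity are odd (`biotSavart2D_neg_of_even`, `gradient_neg_of_even`), so **`Λ_G` maps even
  functions to even functions** (`stub_cellSolvability_evenness`, registered sub-goal);
* the circle `θ ↦ (r cos θ, r sin θ)` has velocity `ξ_θ^⊥` (`hasDerivAt_toLp_cos_sin`), the chain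
  rule `d/dθ w(ξ_θ) = Dw(ξ_θ)[ξ_θ^⊥]`, and therefore **the circle means of the transport term
  vanish**: `∫₀^{2π} ⟪v^G, ∇w⟫(r cos θ, r sin θ) dθ = 0` for every `C¹` function `w`
  (`stub_cellSolvability_transportCircleMean`, registered sub-goal) — the `m = 0` angular mode is
  invisible to `Λ_G`, which is why the stub's data `g` must have vanishing circle means;
* **`Λ_G` is an exact angular derivative**: if `(K∗w)(ξ) = ∇^⊥Ψ(ξ)` (a stream function) then
  `Λ_G w(ξ) = ⟪ξ^⊥, ∇(Ω w + (G/2) Ψ)(ξ)⟫`, `Ω = (8π)⁻¹φ(|·|²/4)`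
  (`stub_cellSolvability_angularPotential`, registered sub-goal): the identity behind the
  mode-wise reduction of `Λ_G w = g` to `im(Ω w_m + (G/2)ψ_m) = g_m`, `Δ_m ψ_m = w_m`, i.e. to the
  Rayleigh-type equation `Δ_m ψ_m + (G/(2Ω)) ψ_m = g_m/(imΩ)` of Gallay–Wayne 2007, proof of
  Prop. 3.1 (`h = g/(2φ)` there, `m = 2`).

## References

* Th. Gallay, C. E. Wayne, *Existence and stability of asymmetric Burgers vortices*, J. Math.
  Fluid Mech. 9 (2007) 243–261 = arXiv:math/0503353, §1 (definition of `Λ`) and §3, Prop. 3.1.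
  [GallayWayne2006]
* Th. Gallay, Y. Maekawa, *Existence and stability of viscous vortices*, arXiv:1610.08384, §2.1
  Observation 3 and §2.2, Lemma 2.7. [GallayMaekawa2016]
-/

set_option linter.dupNamespace false

noncomputable section

open scoped BigOperators Topology RealInnerProductSpace ContDiff
open Filter Set Function MeasureTheory WithLp

namespace Summit.AnomalousDissipation.AnomalousDissipation.Theorems.MarginalStabilityChainStretchedVortexRows

open Literature.Analysis.FluidPDE

/-! ### Gradients in the plane -/

/-- `⟪v, ∇f(x)⟫ = Df(x) v` over `ℝ` (no conjugation). [folklore] -/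
theorem real_inner_gradient_right (f : EuclideanSpace ℝ (Fin 2) → ℝ)
    (x v : EuclideanSpace ℝ (Fin 2)) :
    ⟪v, gradient f x⟫ = fderiv ℝ f x v := by
  rw [real_inner_comm, gradient, InnerProductSpace.toDual_symm_apply]

/-- `⟪∇f(x), v⟫ = Df(x) v` over `ℝ`. [folklore] -/
theorem real_inner_gradient_left (f : EuclideanSpace ℝ (Fin 2) → ℝ)
    (x v : EuclideanSpace ℝ (Fin 2)) :
    ⟪gradient f x, v⟫ = fderiv ℝ f x v := by
  rw [gradient, InnerProductSpace.toDual_symm_apply]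

/-- `∇G(ξ) = −(G(ξ)/2) ξ`: the gradient of the Gaussian is radial (vector form of the tree's
`fderiv_gaussVortexProfile_apply`). [folklore] -/
theorem gradient_gaussVortexProfile (ξ : EuclideanSpace ℝ (Fin 2)) :
    gradient gaussVortexProfile ξ = -(gaussVortexProfile ξ / 2) • ξ := by
  refine ext_inner_right ℝ fun v => ?_
  rw [real_inner_gradient_left, fderiv_gaussVortexProfile_apply, real_inner_smul_left]

/-- Only the radial velocity is seen by `∇G`: `⟪K∗w(ξ), ∇G(ξ)⟫ = −(G(ξ)/2) ⟪K∗w(ξ), ξ⟫`.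
[folklore] -/
theorem inner_biotSavart2D_gradient_gaussVortexProfile (w : EuclideanSpace ℝ (Fin 2) → ℝ)
    (ξ : EuclideanSpace ℝ (Fin 2)) :
    ⟪biotSavart2D w ξ, gradient gaussVortexProfile ξ⟫ =
      -(gaussVortexProfile ξ / 2) * ⟪biotSavart2D w ξ, ξ⟫ := by
  rw [gradient_gaussVortexProfile, real_inner_smul_right]

/-- The transport term as an angular derivative, inner-product form:
`⟪v^G(ξ), ∇w(ξ)⟫ = (8π)⁻¹ φ(|ξ|²/4) ⟪ξ^⊥, ∇w(ξ)⟫` (cf. the `fderiv` form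
`inner_gaussVortexVelocity_gradient_eq_mul_angularDeriv` of the sibling file). [folklore] -/
theorem inner_gaussVortexVelocity_gradient_eq_mul_inner_perp (w : EuclideanSpace ℝ (Fin 2) → ℝ)
    (ξ : EuclideanSpace ℝ (Fin 2)) :
    ⟪gaussVortexVelocity ξ, gradient w ξ⟫ =
      (8 * Real.pi)⁻¹ * burgersPhi (‖ξ‖ ^ 2 / 4) * ⟪perp ξ, gradient w ξ⟫ := by
  rw [gaussVortexVelocity, real_inner_smul_left]

/-- The rotated point `cos t · ξ + sin t · ξ^⊥` stays on the circle through `ξ` (private copy of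
`…StubCoreInverseTools.norm_cos_smul_add_sin_smul_perp`). [folklore] -/
private theorem norm_cos_smul_add_sin_smul_perp' (ξ : EuclideanSpace ℝ (Fin 2)) (t : ℝ) :
    ‖Real.cos t • ξ + Real.sin t • perp ξ‖ = ‖ξ‖ := by
  have h2 : ‖Real.cos t • ξ + Real.sin t • perp ξ‖ ^ 2 = ‖ξ‖ ^ 2 := by
    rw [norm_add_sq_real, norm_smul, norm_smul, real_inner_smul_left, real_inner_smul_right,
      inner_perp_self_right, norm_perp, Real.norm_eq_abs, Real.norm_eq_abs, mul_pow, mul_pow,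
      sq_abs, sq_abs]
    linear_combination ‖ξ‖ ^ 2 * Real.cos_sq_add_sin_sq t
  exact (pow_left_inj₀ (norm_nonneg _) (norm_nonneg _) two_ne_zero).1 h2

/-- **A radial function has no angular derivative**: `Dh(ξ)[ξ^⊥] = 0` whenever `h(y)` depends only
on `|y|` (differentiate `t ↦ h(cos t · ξ + sin t · ξ^⊥) = h(ξ)` at `t = 0`; at points of
non-differentiability `fderiv = 0`). Private copy of
`…StubCoreInverseTools.fderiv_perp_eq_zero_of_radial`. [folklore] -/
private theorem fderiv_perp_eq_zero_of_radial' {h : EuclideanSpace ℝ (Fin 2) → ℝ}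
    (hrad : ∀ y z : EuclideanSpace ℝ (Fin 2), ‖y‖ = ‖z‖ → h y = h z) (ξ : EuclideanSpace ℝ (Fin 2)) :
    fderiv ℝ h ξ (perp ξ) = 0 := by
  by_cases hd : DifferentiableAt ℝ h ξ
  · have hγ := ((Real.hasDerivAt_cos (0 : ℝ)).smul_const ξ).add
      ((Real.hasDerivAt_sin (0 : ℝ)).smul_const (perp ξ))
    simp only [Real.sin_zero, Real.cos_zero, neg_zero, zero_smul, one_smul, zero_add] at hγ
    have h0 : ((fun y : ℝ => Real.cos y • ξ) + fun y : ℝ => Real.sin y • perp ξ) 0 = ξ := by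
      simp
    have hd' : HasFDerivAt h (fderiv ℝ h ξ)
        (((fun y : ℝ => Real.cos y • ξ) + fun y : ℝ => Real.sin y • perp ξ) 0) := by
      rw [h0]; exact hd.hasFDerivAt
    have hcomp := hd'.comp_hasDerivAt (0 : ℝ) hγ
    have hconst : HasDerivAt (fun _ : ℝ => h ξ) (fderiv ℝ h ξ (perp ξ)) 0 := by
      refine hcomp.congr_of_eventuallyEq (Eventually.of_forall fun t => ?_)
      simp only [Function.comp_apply, Pi.add_apply]
      exact hrad _ _ (norm_cos_smul_add_sin_smul_perp' ξ t).symm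
    exact hconst.unique (hasDerivAt_const (0 : ℝ) (h ξ))
  · rw [fderiv_zero_of_not_differentiableAt hd]; rfl

/-! ### Point symmetry: `Λ_G` preserves evenness -/

/-- `G` is even. [folklore] -/
theorem gaussVortexProfile_neg (ξ : EuclideanSpace ℝ (Fin 2)) :
    gaussVortexProfile (-ξ) = gaussVortexProfile ξ := by
  simp [gaussVortexProfile, norm_neg]

/-- `v^G` is odd. [folklore] -/
theorem gaussVortexVelocity_neg (ξ : EuclideanSpace ℝ (Fin 2)) :
    gaussVortexVelocity (-ξ) = -gaussVortexVelocity ξ := by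
  rw [gaussVortexVelocity, gaussVortexVelocity, norm_neg, perp_neg, smul_neg]

/-- `K_{2D}` is odd. [folklore] -/
theorem biotSavartKernel2D_neg (x : EuclideanSpace ℝ (Fin 2)) :
    biotSavartKernel2D (-x) = -biotSavartKernel2D x := by
  rw [biotSavartKernel2D, biotSavartKernel2D, norm_neg, perp_neg, smul_neg]

/-- `∇G` is odd. [folklore] -/
theorem gradient_gaussVortexProfile_neg (ξ : EuclideanSpace ℝ (Fin 2)) :
    gradient gaussVortexProfile (-ξ) = -gradient gaussVortexProfile ξ := by
  rw [gradient_gaussVortexProfile, gradient_gaussVortexProfile, gaussVortexProfile_neg, smul_neg]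

/-- The Biot–Savart velocity of an even vorticity is odd (change of variables `y ↦ −y` in the
Bochner integral; no integrability needed). [folklore] -/
theorem biotSavart2D_neg_of_even {w : EuclideanSpace ℝ (Fin 2) → ℝ} (hw : ∀ y, w (-y) = w y)
    (x : EuclideanSpace ℝ (Fin 2)) :
    biotSavart2D w (-x) = -biotSavart2D w x := by
  have hT : ∀ z : EuclideanSpace ℝ (Fin 2), perp (LinearIsometryEquiv.neg ℝ z) =
      (1 : ℝ) • LinearIsometryEquiv.neg ℝ (perp z) := fun z => by simp [perp_neg]
  have h := biotSavart2D_linearIsometryEquiv (LinearIsometryEquiv.neg ℝ) hT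
    (w := w) (fun y => hw y) x
  simpa using h

/-- The derivative of an even function is odd (no differentiability needed: both sides are the
junk value `0` at a point of non-differentiability). [folklore] -/
theorem fderiv_neg_of_even {w : EuclideanSpace ℝ (Fin 2) → ℝ} (hw : ∀ y, w (-y) = w y)
    (x : EuclideanSpace ℝ (Fin 2)) :
    fderiv ℝ w (-x) = -fderiv ℝ w x := by
  have h := fderiv_comp_smul (f := w) (x := x) (-1 : ℝ)
  have hfun : (fun y : EuclideanSpace ℝ (Fin 2) => w ((-1 : ℝ) • y)) = w := funext fun y => by
    rw [neg_one_smul]; exact hw y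
  rw [hfun, neg_one_smul, neg_one_smul] at h
  rw [h, neg_neg]

/-- The gradient of an even function is odd. [folklore] -/
theorem gradient_neg_of_even {w : EuclideanSpace ℝ (Fin 2) → ℝ} (hw : ∀ y, w (-y) = w y)
    (x : EuclideanSpace ℝ (Fin 2)) :
    gradient w (-x) = -gradient w x := by
  simp only [gradient, fderiv_neg_of_even hw x, map_neg]

/-- **`Λ_G` maps even functions to even functions** (registered on stmt-AnomalousDissipation-3009
as the sub-goal `stub_cellSolvability_evenness`): for an even vorticity `w` the function
`ξ ↦ ⟪v^G(ξ), ∇w(ξ)⟫ + ⟪(K∗w)(ξ), ∇G(ξ)⟫` is even — all four factors are odd. This is why the cell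
problem `Λ_G w = g` with point-symmetric data can be solved in the point-symmetric class, where
the `m = ±1` part of `ker Λ_G = X₀ ⊕ span{∂₁G, ∂₂G}` is absent. [folklore] -/
theorem stub_cellSolvability_evenness : ∀ w : EuclideanSpace ℝ (Fin 2) → ℝ,
    (∀ ξ, w (-ξ) = w ξ) → ∀ ξ : EuclideanSpace ℝ (Fin 2),
      ⟪gaussVortexVelocity (-ξ), gradient w (-ξ)⟫ +
          ⟪biotSavart2D w (-ξ), gradient gaussVortexProfile (-ξ)⟫ =
        ⟪gaussVortexVelocity ξ, gradient w ξ⟫ +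
          ⟪biotSavart2D w ξ, gradient gaussVortexProfile ξ⟫ := by
  intro w hw ξ
  rw [gaussVortexVelocity_neg, gradient_neg_of_even hw, biotSavart2D_neg_of_even hw,
    gradient_gaussVortexProfile_neg, inner_neg_neg, inner_neg_neg]

/-! ### Circles, angular derivatives, circle means -/

/-- The circle point `(r cos θ, r sin θ)` in the standard basis. [folklore] -/
theorem toLp_cos_sin_eq (r θ : ℝ) :
    (toLp 2 ![r * Real.cos θ, r * Real.sin θ] : EuclideanSpace ℝ (Fin 2)) =
      (r * Real.cos θ) • EuclideanSpace.single 0 (1 : ℝ) +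
        (r * Real.sin θ) • EuclideanSpace.single 1 (1 : ℝ) := by
  ext i
  fin_cases i <;> simp

/-- `(r cos θ, r sin θ)^⊥ = (−r sin θ, r cos θ)` in the standard basis. [folklore] -/
theorem perp_toLp_cos_sin_eq (r θ : ℝ) :
    perp (toLp 2 ![r * Real.cos θ, r * Real.sin θ] : EuclideanSpace ℝ (Fin 2)) =
      (-(r * Real.sin θ)) • EuclideanSpace.single 0 (1 : ℝ) +
        (r * Real.cos θ) • EuclideanSpace.single 1 (1 : ℝ) := by
  ext i
  fin_cases i <;> simp [perp]

/-- `|(r cos θ, r sin θ)| = |r|`. [folklore] -/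
theorem norm_toLp_cos_sin (r θ : ℝ) :
    ‖(toLp 2 ![r * Real.cos θ, r * Real.sin θ] : EuclideanSpace ℝ (Fin 2))‖ = |r| := by
  rw [EuclideanSpace.norm_eq, ← Real.sqrt_sq_eq_abs]
  congr 1
  simp only [Fin.sum_univ_two, Matrix.cons_val_zero, Matrix.cons_val_one,
    Matrix.cons_val_fin_one, Real.norm_eq_abs, sq_abs]
  linear_combination r ^ 2 * (Real.cos_sq_add_sin_sq θ)

/-- The circle `θ ↦ (r cos θ, r sin θ)` has velocity `ξ_θ^⊥`. [folklore] -/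
theorem hasDerivAt_toLp_cos_sin (r θ : ℝ) :
    HasDerivAt (fun θ : ℝ => (toLp 2 ![r * Real.cos θ, r * Real.sin θ] : EuclideanSpace ℝ (Fin 2)))
      (perp (toLp 2 ![r * Real.cos θ, r * Real.sin θ])) θ := by
  rw [perp_toLp_cos_sin_eq]
  have h := (((Real.hasDerivAt_cos θ).const_mul r).smul_const
      (EuclideanSpace.single (0 : Fin 2) (1 : ℝ))).add
    (((Real.hasDerivAt_sin θ).const_mul r).smul_const (EuclideanSpace.single (1 : Fin 2) (1 : ℝ)))
  simp only [mul_neg] at h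
  refine h.congr_of_eventuallyEq (Eventually.of_forall fun t => ?_)
  exact toLp_cos_sin_eq r t

/-- Chain rule along a circle: `d/dθ w(ξ_θ) = Dw(ξ_θ)[ξ_θ^⊥]`, `ξ_θ = (r cos θ, r sin θ)`.
[folklore] -/
theorem hasDerivAt_comp_toLp_cos_sin {w : EuclideanSpace ℝ (Fin 2) → ℝ} {r θ : ℝ}
    (hw : DifferentiableAt ℝ w (toLp 2 ![r * Real.cos θ, r * Real.sin θ])) :
    HasDerivAt (fun θ : ℝ => w (toLp 2 ![r * Real.cos θ, r * Real.sin θ]))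
      (fderiv ℝ w (toLp 2 ![r * Real.cos θ, r * Real.sin θ])
        (perp (toLp 2 ![r * Real.cos θ, r * Real.sin θ]))) θ :=
  hw.hasFDerivAt.comp_hasDerivAt θ (hasDerivAt_toLp_cos_sin r θ)

/-- The circle map is continuous in the angle. [folklore] -/
theorem continuous_toLp_cos_sin (r : ℝ) :
    Continuous fun θ : ℝ => (toLp 2 ![r * Real.cos θ, r * Real.sin θ] : EuclideanSpace ℝ (Fin 2)) :=
  continuous_iff_continuousAt.2 fun θ => (hasDerivAt_toLp_cos_sin r θ).continuousAt

/-- **The circle means of the transport term vanish** (registered on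
stmt-AnomalousDissipation-3009 as the sub-goal `stub_cellSolvability_transportCircleMean`). For
every `C¹` function `w` and every radius `r`, `∫₀^{2π} ⟪v^G, ∇w⟫(r cos θ, r sin θ) dθ = 0`: on the
circle the integrand is `Ω(r) d/dθ [w(ξ_θ)]` and `w(ξ_{2π}) = w(ξ_0)`. (So `Λ_G w = g` forces the
datum `g` to carry the circle means of `⟪K∗w, ∇G⟫`, which vanish as well by incompressibility:
the `m = 0` mode is not in the range of `Λ_G`.) [folklore] -/
theorem stub_cellSolvability_transportCircleMean : ∀ w : EuclideanSpace ℝ (Fin 2) → ℝ,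
    ContDiff ℝ 1 w → ∀ r : ℝ,
      ∫ θ in (0 : ℝ)..(2 * Real.pi),
        ⟪gaussVortexVelocity (toLp 2 ![r * Real.cos θ, r * Real.sin θ]),
          gradient w (toLp 2 ![r * Real.cos θ, r * Real.sin θ])⟫ = 0 := by
  intro w hw r
  have hd : Differentiable ℝ w := hw.differentiable (by simp)
  have hc : ∀ θ : ℝ, ⟪gaussVortexVelocity (toLp 2 ![r * Real.cos θ, r * Real.sin θ]),
      gradient w (toLp 2 ![r * Real.cos θ, r * Real.sin θ])⟫ =
      (8 * Real.pi)⁻¹ * burgersPhi (r ^ 2 / 4) *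
        fderiv ℝ w (toLp 2 ![r * Real.cos θ, r * Real.sin θ])
          (perp (toLp 2 ![r * Real.cos θ, r * Real.sin θ])) := fun θ => by
    rw [inner_gaussVortexVelocity_gradient_eq_mul_inner_perp, real_inner_gradient_right,
      norm_toLp_cos_sin, sq_abs]
  simp_rw [hc, intervalIntegral.integral_const_mul]
  rw [intervalIntegral.integral_eq_sub_of_hasDerivAt
    (f := fun θ : ℝ => w (toLp 2 ![r * Real.cos θ, r * Real.sin θ]))
    (fun θ _ => hasDerivAt_comp_toLp_cos_sin (hd _))]
  · simp
  · refine Continuous.intervalIntegrable ?_ _ _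
    exact ((hw.continuous_fderiv (by simp)).comp (continuous_toLp_cos_sin r)).clm_apply
      (continuous_perp.comp (continuous_toLp_cos_sin r))

/-! ### `Λ_G` is an exact angular derivative -/

/-- The angular velocity `Ω(η) = (8π)⁻¹ φ(|η|²/4)` is smooth. [folklore] -/
theorem contDiff_gaussAngularVelocity {n : WithTop ℕ∞} :
    ContDiff ℝ n fun η : EuclideanSpace ℝ (Fin 2) => (8 * Real.pi)⁻¹ * burgersPhi (‖η‖ ^ 2 / 4) :=
  contDiff_const.mul (contDiff_burgersPhi.comp ((contDiff_norm_sq ℝ).div_const _))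

/-- **`Λ_G w` is the angular derivative of the cell potential `Ω w + (G/2) Ψ`** (registered on
stmt-AnomalousDissipation-3009 as the sub-goal `stub_cellSolvability_angularPotential`). If `Ψ`
is a stream function of `w` at `ξ`, i.e. `(K∗w)(ξ) = ∇^⊥Ψ(ξ)`, and `w`, `Ψ` are differentiable at
`ξ`, then `⟪v^G(ξ), ∇w(ξ)⟫ + ⟪(K∗w)(ξ), ∇G(ξ)⟫ = ⟪ξ^⊥, ∇(Ω w + (G/2)Ψ)(ξ)⟫` with
`Ω = (8π)⁻¹φ(|·|²/4)`: `v^G·∇w = Ω ∂_θ w`, `(K∗w)·∇G = −(G/2)⟪∇^⊥Ψ, ξ⟫ = (G/2) ∂_θΨ`, and the radial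
factors `Ω`, `G/2` have no angular derivative. In angular Fourier modes this is the reduction of
`Λ_G w = g` to `im (Ω w_m + (G/2) ψ_m) = g_m` of Gallay–Wayne 2007, proof of Prop. 3.1.
[folklore] -/
theorem stub_cellSolvability_angularPotential :
    ∀ (w Ψ : EuclideanSpace ℝ (Fin 2) → ℝ) (ξ : EuclideanSpace ℝ (Fin 2)),
      DifferentiableAt ℝ w ξ → DifferentiableAt ℝ Ψ ξ → biotSavart2D w ξ = perp (gradient Ψ ξ) →
        ⟪gaussVortexVelocity ξ, gradient w ξ⟫ + ⟪biotSavart2D w ξ, gradient gaussVortexProfile ξ⟫ =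
          ⟪perp ξ, gradient (fun η => (8 * Real.pi)⁻¹ * burgersPhi (‖η‖ ^ 2 / 4) * w η +
            gaussVortexProfile η / 2 * Ψ η) ξ⟫ := by
  intro w Ψ ξ hw hΨ hstream
  have hΩ : DifferentiableAt ℝ
      (fun η : EuclideanSpace ℝ (Fin 2) => (8 * Real.pi)⁻¹ * burgersPhi (‖η‖ ^ 2 / 4)) ξ :=
    (contDiff_gaussAngularVelocity (n := 1)).differentiable (by simp) ξ
  have hG : DifferentiableAt ℝ (fun η : EuclideanSpace ℝ (Fin 2) => gaussVortexProfile η / 2) ξ := by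
    have := ((contDiff_gaussVortexProfile (n := 1)).differentiable (by simp) ξ).mul_const
      (2 : ℝ)⁻¹
    simpa only [div_eq_mul_inv] using this
  have hΩrad : ∀ y z : EuclideanSpace ℝ (Fin 2), ‖y‖ = ‖z‖ →
      (8 * Real.pi)⁻¹ * burgersPhi (‖y‖ ^ 2 / 4) = (8 * Real.pi)⁻¹ * burgersPhi (‖z‖ ^ 2 / 4) :=
    fun y z h => by rw [h]
  have hGrad : ∀ y z : EuclideanSpace ℝ (Fin 2), ‖y‖ = ‖z‖ →
      gaussVortexProfile y / 2 = gaussVortexProfile z / 2 :=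
    fun y z h => by simp only [gaussVortexProfile, h]
  have h1 := fderiv_perp_eq_zero_of_radial' hΩrad ξ
  have h2 := fderiv_perp_eq_zero_of_radial' hGrad ξ
  rw [real_inner_gradient_right _ ξ (perp ξ),
    fderiv_fun_add
      (f := fun η : EuclideanSpace ℝ (Fin 2) => (8 * Real.pi)⁻¹ * burgersPhi (‖η‖ ^ 2 / 4) * w η)
      (g := fun η : EuclideanSpace ℝ (Fin 2) => gaussVortexProfile η / 2 * Ψ η) (hΩ.mul hw)
      (hG.mul hΨ),
    fderiv_fun_mul hΩ hw, fderiv_fun_mul hG hΨ]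
  simp only [add_apply, smul_apply, smul_eq_mul, h1, h2, mul_zero, add_zero]
  rw [inner_gaussVortexVelocity_gradient_eq_mul_inner_perp,
    real_inner_gradient_right w ξ (perp ξ),
    inner_biotSavart2D_gradient_gaussVortexProfile, hstream, inner_perp_left (gradient Ψ ξ) ξ,
    real_inner_gradient_left Ψ ξ (perp ξ)]
  ring

/-- Consequence: along every circle, `Λ_G w` integrates to zero as soon as `w` admits a `C¹`
stream function there — the cell potential `Ω w + (G/2)Ψ` returns to its initial value after one
turn. Stated for `C¹` data `w`, `Ψ` with `K∗w = ∇^⊥Ψ` everywhere. [folklore] -/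
theorem intervalIntegral_cellLam_eq_zero_of_stream {w Ψ : EuclideanSpace ℝ (Fin 2) → ℝ}
    (hw : ContDiff ℝ 1 w)
    (hΨ : ContDiff ℝ 1 Ψ) (hstream : ∀ ξ, biotSavart2D w ξ = perp (gradient Ψ ξ)) (r : ℝ) :
    ∫ θ in (0 : ℝ)..(2 * Real.pi),
      (⟪gaussVortexVelocity (toLp 2 ![r * Real.cos θ, r * Real.sin θ]),
          gradient w (toLp 2 ![r * Real.cos θ, r * Real.sin θ])⟫ +
        ⟪biotSavart2D w (toLp 2 ![r * Real.cos θ, r * Real.sin θ]),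
          gradient gaussVortexProfile (toLp 2 ![r * Real.cos θ, r * Real.sin θ])⟫) = 0 := by
  set P : EuclideanSpace ℝ (Fin 2) → ℝ := fun η =>
    (8 * Real.pi)⁻¹ * burgersPhi (‖η‖ ^ 2 / 4) * w η +
    gaussVortexProfile η / 2 * Ψ η with hP
  have hPc : ContDiff ℝ 1 P :=
    (contDiff_gaussAngularVelocity.mul hw).add ((contDiff_gaussVortexProfile.div_const _).mul hΨ)
  have hdw : Differentiable ℝ w := hw.differentiable (by simp)
  have hdΨ : Differentiable ℝ Ψ := hΨ.differentiable (by simp)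
  have hdP : Differentiable ℝ P := hPc.differentiable (by simp)
  have hc : ∀ θ : ℝ,
      ⟪gaussVortexVelocity (toLp 2 ![r * Real.cos θ, r * Real.sin θ]),
          gradient w (toLp 2 ![r * Real.cos θ, r * Real.sin θ])⟫ +
        ⟪biotSavart2D w (toLp 2 ![r * Real.cos θ, r * Real.sin θ]),
          gradient gaussVortexProfile (toLp 2 ![r * Real.cos θ, r * Real.sin θ])⟫ =
      fderiv ℝ P (toLp 2 ![r * Real.cos θ, r * Real.sin θ])
        (perp (toLp 2 ![r * Real.cos θ, r * Real.sin θ])) := fun θ => by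
    rw [stub_cellSolvability_angularPotential w Ψ _ (hdw _) (hdΨ _) (hstream _),
      real_inner_gradient_right]
  simp_rw [hc]
  rw [intervalIntegral.integral_eq_sub_of_hasDerivAt
    (f := fun θ : ℝ => P (toLp 2 ![r * Real.cos θ, r * Real.sin θ]))
    (fun θ _ => hasDerivAt_comp_toLp_cos_sin (hdP _))]
  · simp
  · refine Continuous.intervalIntegrable ?_ _ _
    exact ((hPc.continuous_fderiv (by simp)).comp (continuous_toLp_cos_sin r)).clm_apply
      (continuous_perp.comp (continuous_toLp_cos_sin r))

end Summit.AnomalousDissipation.AnomalousDissipation.Theorems.MarginalStabilityChainStretchedVortexRows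

end
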